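import Mathlib
import HarnessLib
import Summits.NavierStokesRegularity.NavierStokesRegularity.Theses.IsobarTomography
import Literature.Analysis.FluidPDE.AncientMildDrift

/-!
# Route IsobarTomography — structure of the crux `TubeAlternative` (stmt-NavierStokesRegularity-11739)

Support lemmas of the line lead (line `Sketch`), all sorry-free, recording in Lean WHY every line
for this crux reduces to one of two open problems.

1. `tubeAlternative_iff_exists_antecedent_imp` — the crux is `(∃ antecedent) → C` with a
   conclusion `C` that does not mention the blowing-up solution `u`.
2. `blob_of_tubeAlternative_of_isobaricLinesLiouville` / `tubeAlternative_of_typeI_forces_blob` —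
   granted the route's own Liouville crux K2 (`IsobaricLinesLiouville`), the crux is EQUIVALENT to
   "Type-I maximal Leray–Hopf solutions from rapidly decaying data satisfy the blob hypothesis", i.e. to
   the exclusion of its own antecedent (a regularity theorem); conversely that exclusion proves it;
   and an outright proof of the conclusion refutes K2 (`not_isobaricLinesLiouville_of_tubeConclusion`).
3. `isKNSSBlowupLimit_timeProfile`, `isClassicalNSSolutionOn_timeProfile` — the
   tree's duality-form `IsKNSSBlowupLimit` contains every smooth spatially constant time profile
   `v(t,x) = b(t)` with `|b| ≤ 1 = sup |b|` (KNSS 2009 §1 "parasitic solutions"; tree: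
   `isBoundedAncientMildSolution_timeConst`), each carrying the classical pressure `q = -⟪b'(t), x⟫`
   and irrotational slices; so the first THREE conjuncts of `C` hold trivially
   (`tubeConclusion_dropLast_timeProfile`) and the whole content of `C` is its fourth conjunct
   (a non-slice-constant member), i.e. the negation of KNSS–Liouville in the classical-pressure class.
4. `exists_isKNSSBlowupLimit_not_analyticOnNhd` — a KNSS limit (tree sense) with classical pressure
   that is NOT jointly real-analytic: the plan of the line's stub L1 (`DefectAnalytic`: "restart
   Lemarié-Rieusset Thm 9.12 + `oseenMild_essBounded_unique` ⇒ `v` analytic") cannot be carried out for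
   the tree's predicate, which does not pin the Galilean gauge.
5. `localSelection_of_tubeAlternative` / `antiLiouville_of_localSelection` — the line's bet stub L3
   (`LocalTomographicSelection`) is implied by the crux outright and implies, under the antecedent, a
   non-slice-constant KNSS limit with classical pressure (anti-Liouville); so L3 is crux-sized.
-/

set_option linter.dupNamespace false

noncomputable section

namespace Summit.NavierStokesRegularity.NavierStokesRegularity.Theorems

open Set Filter Topology Function MeasureTheory
open scoped ContDiff RealInnerProductSpace
open Literature.Analysis.FluidPDE
open Summit.NavierStokesRegularity.NavierStokesRegularity.Theses.IsobarTomography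

/-! ## 1. The conclusion does not mention `u` -/

/-- **The crux is `(∃ antecedent) → conclusion`.** `TubeAlternative` unfolds to a universally
quantified implication whose conclusion (some KNSS blow-up limit with classical pressure, isobaric
vortex lines, not slice-wise constant) does not mention `ν, T, u, p`; hence it is equivalent to
"if SOME Type-I maximal Leray–Hopf solution from a rapidly decaying datum violates the blob hypothesis,
then such a limit exists". -/
theorem tubeAlternative_iff_exists_antecedent_imp :
    TubeAlternative ↔
      ((∃ (ν T : ℝ) (u : ℝ → EuclideanSpace ℝ (Fin 3) → EuclideanSpace ℝ (Fin 3))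
          (p : ℝ → EuclideanSpace ℝ (Fin 3) → ℝ), 0 < ν ∧ 0 < T ∧
          IsMaximalSmoothSolution ν 0 u p T ∧ IsLerayHopfOn T ν 0 (u 0) u ∧
          HasRapidSpatialDecay (u 0) ∧ IsTypeIBlowup u T ∧
          ¬ ∃ κ : ℝ, 0 < κ ∧ ∃ Ω : ℝ → ℝ, ∃ t₀ ∈ Set.Ico 0 T, ∀ t ∈ Set.Ico t₀ T,
            (∃ x : EuclideanSpace ℝ (Fin 3), Ω t < ‖curl (u t) x‖) ∧ ∀ x : EuclideanSpace ℝ (Fin 3), Ω t < ‖curl (u t) x‖ →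
              κ * ‖curl (u t) x‖ ^ 2 * Laplacian.laplacian (p t) x ≤
                iteratedFDeriv ℝ 2 (p t) x ![curl (u t) x, curl (u t) x]) →
        ∃ (v : ℝ → EuclideanSpace ℝ (Fin 3) → EuclideanSpace ℝ (Fin 3)) (q : ℝ → EuclideanSpace ℝ (Fin 3) → ℝ),
          IsKNSSBlowupLimit v ∧
          IsClassicalNSSolutionOn (Set.Iio 0) 1 0 v q ∧
          (∀ t < 0, ∀ x : EuclideanSpace ℝ (Fin 3), inner ℝ (curl (v t) x) (gradient (q t) x) = 0) ∧
          ¬ (∀ t < 0, ∃ b : EuclideanSpace ℝ (Fin 3), v t = fun _ => b)) := by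
  unfold TubeAlternative
  constructor
  · rintro h ⟨ν, T, u, p, hν, hT, hmax, hLH, hdec, hI, hnb⟩
    exact h ν T hν hT u p hmax hLH hdec hI hnb
  · intro h ν T hν hT u p hmax hLH hdec hI hnb
    exact h ⟨ν, T, u, p, hν, hT, hmax, hLH, hdec, hI, hnb⟩

/-! ## 2. Granted K2, the crux is the exclusion of its own antecedent -/

/-- **Granted `IsobaricLinesLiouville` (K2), `TubeAlternative` says that Type-I maximal Leray–Hopf
solutions from rapidly decaying data satisfy the blob hypothesis** (the tube branch of the route's
`closes`, isolated): K2 makes every isobaric-lines KNSS limit slice-wise constant, so the crux's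
conclusion is false and its antecedent must fail. -/
theorem blob_of_tubeAlternative_of_isobaricLinesLiouville (hD : TubeAlternative)
    (hL : IsobaricLinesLiouville) :
    ∀ (ν T : ℝ), 0 < ν → 0 < T → ∀ (u : ℝ → EuclideanSpace ℝ (Fin 3) → EuclideanSpace ℝ (Fin 3))
        (p : ℝ → EuclideanSpace ℝ (Fin 3) → ℝ),
      IsMaximalSmoothSolution ν 0 u p T → IsLerayHopfOn T ν 0 (u 0) u →
      HasRapidSpatialDecay (u 0) → IsTypeIBlowup u T →
      ∃ κ : ℝ, 0 < κ ∧ ∃ Ω : ℝ → ℝ, ∃ t₀ ∈ Set.Ico 0 T, ∀ t ∈ Set.Ico t₀ T,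
        (∃ x : EuclideanSpace ℝ (Fin 3), Ω t < ‖curl (u t) x‖) ∧ ∀ x : EuclideanSpace ℝ (Fin 3), Ω t < ‖curl (u t) x‖ →
          κ * ‖curl (u t) x‖ ^ 2 * Laplacian.laplacian (p t) x ≤
            iteratedFDeriv ℝ 2 (p t) x ![curl (u t) x, curl (u t) x] := by
  intro ν T hν hT u p hmax hLH hdec hI
  by_contra hnb
  obtain ⟨v, q, hv, hvq, hcol, hnc⟩ := hD ν T hν hT u p hmax hLH hdec hI hnb
  exact hnc (hL v q hv.isBoundedAncientMildSolution hvq hcol)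

/-- **Conversely, exclusion of the antecedent proves the crux**: if every Type-I maximal Leray–Hopf
solution from a rapidly decaying datum satisfies the blob hypothesis, `TubeAlternative` holds
(vacuously). Together with `blob_of_tubeAlternative_of_isobaricLinesLiouville`: granted K2, the crux
is EQUIVALENT to this regularity statement and contributes nothing beyond it. -/
theorem tubeAlternative_of_typeI_forces_blob
    (h : ∀ (ν T : ℝ), 0 < ν → 0 < T → ∀ (u : ℝ → EuclideanSpace ℝ (Fin 3) → EuclideanSpace ℝ (Fin 3))
        (p : ℝ → EuclideanSpace ℝ (Fin 3) → ℝ),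
      IsMaximalSmoothSolution ν 0 u p T → IsLerayHopfOn T ν 0 (u 0) u →
      HasRapidSpatialDecay (u 0) → IsTypeIBlowup u T →
      ∃ κ : ℝ, 0 < κ ∧ ∃ Ω : ℝ → ℝ, ∃ t₀ ∈ Set.Ico 0 T, ∀ t ∈ Set.Ico t₀ T,
        (∃ x : EuclideanSpace ℝ (Fin 3), Ω t < ‖curl (u t) x‖) ∧ ∀ x : EuclideanSpace ℝ (Fin 3), Ω t < ‖curl (u t) x‖ →
          κ * ‖curl (u t) x‖ ^ 2 * Laplacian.laplacian (p t) x ≤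
            iteratedFDeriv ℝ 2 (p t) x ![curl (u t) x, curl (u t) x]) :
    TubeAlternative := by
  intro ν T hν hT u p hmax hLH hdec hI hnb
  exact absurd (h ν T hν hT u p hmax hLH hdec hI) hnb

/-- **The conclusion of the crux refutes K2.** A KNSS limit with classical pressure and isobaric
vortex lines that is not slice-wise constant is a counterexample to `IsobaricLinesLiouville`; so an
OUTRIGHT proof of the crux's conclusion (the only way to prove the crux without excluding its
antecedent) kills the route's rank-4 crux. -/
theorem not_isobaricLinesLiouville_of_tubeConclusion
    (hC : ∃ (v : ℝ → EuclideanSpace ℝ (Fin 3) → EuclideanSpace ℝ (Fin 3)) (q : ℝ → EuclideanSpace ℝ (Fin 3) → ℝ),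
          IsKNSSBlowupLimit v ∧
      IsClassicalNSSolutionOn (Set.Iio 0) 1 0 v q ∧
      (∀ t < 0, ∀ x : EuclideanSpace ℝ (Fin 3), inner ℝ (curl (v t) x) (gradient (q t) x) = 0) ∧
      ¬ (∀ t < 0, ∃ b : EuclideanSpace ℝ (Fin 3), v t = fun _ => b)) :
    ¬ IsobaricLinesLiouville := by
  rintro hL
  obtain ⟨v, q, hv, hvq, hcol, hnc⟩ := hC
  exact hnc (hL v q hv.isBoundedAncientMildSolution hvq hcol)

/-! ## 3. The gauge family of spatially constant time profiles -/

/-- **Spatially constant time profiles are KNSS blow-up limits (tree sense).** For every smooth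
`b : ℝ → ℝ³` with `‖b t‖ ≤ 1` for `t < 0` and `sup_{t<0} ‖b t‖ = 1`, the field `v(t,x) = b(t)` is an
`IsKNSSBlowupLimit`: it is a bounded ancient mild solution of the duality-form class
(`isBoundedAncientMildSolution_timeConst`, KNSS 2009 §1 "parasitic solutions `u(x,t) = b(t)`"),
measurable, jointly smooth, and normalised. The genuinely mild (Oseen/Duhamel) class of KNSS would
force `b` to be constant; the tree's predicate does not. -/
theorem isKNSSBlowupLimit_timeProfile {b : ℝ → (EuclideanSpace ℝ (Fin 3))} (hb : ContDiff ℝ ∞ b)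
    (h1 : ∀ t < 0, ‖b t‖ ≤ 1) (h2 : ∀ ε : ℝ, 0 < ε → ∃ t < 0, 1 - ε < ‖b t‖) :
    IsKNSSBlowupLimit (fun t _ => b t) where
  isBoundedAncientMildSolution := isBoundedAncientMildSolution_timeConst 1 ⟨1, h1⟩
  aestronglyMeasurable := fun _ _ => aestronglyMeasurable_const
  smooth := by
    show ContDiffOn ℝ ∞ (fun z : ℝ × (EuclideanSpace ℝ (Fin 3)) => b z.1) _
    exact (hb.comp contDiff_fst).contDiffOn
  norm_le_one := fun t ht _ => h1 t ht
  exists_lt_norm := fun ε hε => by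
    obtain ⟨t, ht, hlt⟩ := h2 ε hε
    exact ⟨t, ht, 0, hlt⟩

/-- **The classical pressure of a time profile.** For smooth `b`, the pair
`(v, q) = (b(t), -⟪b'(t), x⟫)` is a classical Navier–Stokes solution (`ν = 1`, zero force) on
`(-∞, 0) × ℝ³`: `∂ₜv = b' = -∇q`, all space derivatives of `v` vanish. -/
theorem isClassicalNSSolutionOn_timeProfile {b : ℝ → (EuclideanSpace ℝ (Fin 3))} (hb : ContDiff ℝ ∞ b) :
    IsClassicalNSSolutionOn (Set.Iio 0) 1 0 (fun t _ => b t)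
      (fun t x => ⟪-deriv b t, x⟫) where
  smooth_velocity := by
    show ContDiffOn ℝ ∞ (fun z : ℝ × (EuclideanSpace ℝ (Fin 3)) => b z.1) _
    exact (hb.comp contDiff_fst).contDiffOn
  smooth_pressure := by
    have hb' : ContDiff ℝ ∞ (deriv b) := (contDiff_infty_iff_deriv.mp hb).2
    show ContDiffOn ℝ ∞ (fun z : ℝ × (EuclideanSpace ℝ (Fin 3)) => ⟪-deriv b z.1, z.2⟫) _
    exact ((hb'.comp contDiff_fst).neg.inner ℝ contDiff_snd).contDiffOn
  momentum := by
    intro t ht x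
    -- `∇⟪c, ·⟫ = c` (the gradient of a linear form), here with `c = -b′(t)`
    have hgrad : ∀ c : EuclideanSpace ℝ (Fin 3),
        gradient (fun y : EuclideanSpace ℝ (Fin 3) => ⟪c, y⟫) x = c := fun c => by
      refine HasGradientAt.gradient ?_
      rw [hasGradientAt_iff_hasFDerivAt]
      exact (InnerProductSpace.toDual ℝ (EuclideanSpace ℝ (Fin 3)) c).hasFDerivAt
    simp only [timeDerivWithin_apply, convect_apply, fderiv_fun_const, Pi.zero_apply,
      _root_.zero_apply, add_zero, InnerProductSpace.laplacian_const, smul_zero,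
      hgrad, zero_sub, neg_neg]
    exact derivWithin_of_isOpen isOpen_Iio ht
  divFree := fun t _ x => by simp [VectorCalculus.divergence]

/-- **The first three conjuncts of the crux's conclusion are free.** Every admissible time profile
witnesses "KNSS limit ∧ classical pressure ∧ isobaric vortex lines" (the slices are irrotational);
only the fourth conjunct (not slice-wise constant) fails, and it fails for the whole gauge family.
Hence the conclusion of `TubeAlternative` is exactly the existence of a NON-slice-constant bounded
ancient solution of the tree's class with classical pressure and `ω·∇q ≡ 0` — the negation of the
route's K2 restricted to normalised smooth members. -/
theorem tubeConclusion_dropLast_timeProfile {b : ℝ → (EuclideanSpace ℝ (Fin 3))} (hb : ContDiff ℝ ∞ b)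
    (h1 : ∀ t < 0, ‖b t‖ ≤ 1) (h2 : ∀ ε : ℝ, 0 < ε → ∃ t < 0, 1 - ε < ‖b t‖) :
    IsKNSSBlowupLimit (fun t (_ : EuclideanSpace ℝ (Fin 3)) => b t) ∧
      IsClassicalNSSolutionOn (Set.Iio 0) 1 0 (fun t (_ : EuclideanSpace ℝ (Fin 3)) => b t)
        (fun t x => ⟪-deriv b t, x⟫) ∧
      (∀ t < 0, ∀ x : EuclideanSpace ℝ (Fin 3),
        inner ℝ (curl ((fun t (_ : EuclideanSpace ℝ (Fin 3)) => b t) t) x)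
          (gradient ((fun t (x : EuclideanSpace ℝ (Fin 3)) => ⟪-deriv b t, x⟫) t) x) = 0) ∧
      (∀ t < 0, ∃ c : EuclideanSpace ℝ (Fin 3), (fun t (_ : EuclideanSpace ℝ (Fin 3)) => b t) t = fun _ => c) :=
  ⟨isKNSSBlowupLimit_timeProfile hb h1 h2, isClassicalNSSolutionOn_timeProfile hb,
    fun t _ x => by
      have hc : curl (fun _ : EuclideanSpace ℝ (Fin 3) => b t) x = 0 := by simp [curl]
      beta_reduce
      rw [hc, inner_zero_left],
    fun t _ => ⟨b t, rfl⟩⟩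

/-! ## 4. A KNSS limit (tree sense) that is not real-analytic in time -/

/-- **KNSS limits of the tree's class need not be jointly real-analytic.** The time profile
`v(t,x) = χ(t+2) e₀` with Mathlib's `Real.smoothTransition` `χ` (smooth, `= 0` on `t ≤ -2`, `= 1` on
`t ≥ -1`, values in `[0,1]`) is an `IsKNSSBlowupLimit` with a classical pressure, but `uncurry v` is
not `AnalyticOnNhd` on the slab `(-∞,0) × ℝ³`: along the line `x = 0` it vanishes on `(-∞,-2)` and
equals `e₀ ≠ 0` at `t = -1`, contradicting the identity theorem on the preconnected `(-∞,0)`.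
Consequence for line `Sketch`: stub L1's printed route ("restart the local analyticity theorem at
each `s < 0` and identify by bounded uniqueness, so `v` is analytic") is unavailable for the tree's
predicate; the duality-form class does not pin the Galilean gauge. -/
theorem exists_isKNSSBlowupLimit_not_analyticOnNhd :
    ∃ v : ℝ → EuclideanSpace ℝ (Fin 3) → EuclideanSpace ℝ (Fin 3), IsKNSSBlowupLimit v ∧
      (∃ q : ℝ → EuclideanSpace ℝ (Fin 3) → ℝ, IsClassicalNSSolutionOn (Set.Iio 0) 1 0 v q) ∧
      ¬ AnalyticOnNhd ℝ (uncurry v) (Set.Iio (0 : ℝ) ×ˢ (Set.univ : Set (EuclideanSpace ℝ (Fin 3)))) := by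
  set e₀ : EuclideanSpace ℝ (Fin 3) := EuclideanSpace.single 0 1 with he₀
  have he₀n : ‖e₀‖ = 1 := by simp [he₀]
  set b : ℝ → (EuclideanSpace ℝ (Fin 3)) := fun t => Real.smoothTransition (t + 2) • e₀ with hbdef
  have hb : ContDiff ℝ ∞ b :=
    (Real.smoothTransition.contDiff.comp (contDiff_id.add contDiff_const)).smul contDiff_const
  have hnorm : ∀ t, ‖b t‖ = Real.smoothTransition (t + 2) := fun t => by
    simp only [hbdef, norm_smul, he₀n, mul_one, Real.norm_of_nonneg (Real.smoothTransition.nonneg _)]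
  have h1 : ∀ t < 0, ‖b t‖ ≤ 1 := fun t _ => by
    rw [hnorm]; exact Real.smoothTransition.le_one _
  have hbm1 : b (-1) = e₀ := by
    simp only [hbdef]
    rw [Real.smoothTransition.one_of_one_le (by norm_num), one_smul]
  have h2 : ∀ ε : ℝ, 0 < ε → ∃ t < 0, 1 - ε < ‖b t‖ := fun ε hε =>
    ⟨-1, by norm_num, by rw [hbm1, he₀n]; linarith⟩
  refine ⟨fun t _ => b t, isKNSSBlowupLimit_timeProfile hb h1 h2,
    ⟨_, isClassicalNSSolutionOn_timeProfile hb⟩, fun hA => ?_⟩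
  -- restrict to the analytic line `t ↦ (t, 0)`
  have hban : AnalyticOnNhd ℝ b (Set.Iio 0) := by
    intro t ht
    have hι : AnalyticAt ℝ (fun s : ℝ => (s, (0 : EuclideanSpace ℝ (Fin 3)))) t := analyticAt_id.prod analyticAt_const
    have hAt : AnalyticAt ℝ (uncurry fun (s : ℝ) (_ : EuclideanSpace ℝ (Fin 3)) => b s) (t, (0 : EuclideanSpace ℝ (Fin 3))) :=
      hA (t, 0) ⟨ht, Set.mem_univ _⟩
    exact hAt.comp_of_eq (f := fun s : ℝ => (s, (0 : EuclideanSpace ℝ (Fin 3)))) hι rfl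
  have hgerm : b =ᶠ[𝓝 (-3 : ℝ)] 0 := by
    filter_upwards [Iio_mem_nhds (show (-3 : ℝ) < -2 by norm_num)] with t ht
    simp only [hbdef, Pi.zero_apply]
    rw [Real.smoothTransition.zero_of_nonpos (by simp only [Set.mem_Iio] at ht; linarith), zero_smul]
  have hzero := hban.eqOn_zero_of_preconnected_of_eventuallyEq_zero
    (convex_Iio (0 : ℝ)).isPreconnected (show (-3 : ℝ) ∈ Set.Iio 0 by norm_num) hgerm
  have h0 : b (-1) = 0 := hzero (show (-1 : ℝ) ∈ Set.Iio 0 by norm_num)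
  rw [hbm1] at h0
  have : ‖e₀‖ = 0 := by rw [h0, norm_zero]
  rw [he₀n] at this
  exact one_ne_zero this

/-! ## 5. The line's bet stub is crux-sized -/

/-- **The crux implies the localised selection outright.** If some KNSS limit has isobaric defect
vanishing on the whole slab, its defect vanishes on a neighbourhood of the interior point `(-1, 0)`.
So the line's stub L3 (`LocalTomographicSelection`) is not a weakening of the crux in truth value. -/
theorem localSelection_of_tubeAlternative (hD : TubeAlternative) :
    ∀ (ν T : ℝ) (u : ℝ → EuclideanSpace ℝ (Fin 3) → EuclideanSpace ℝ (Fin 3))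
        (p : ℝ → EuclideanSpace ℝ (Fin 3) → ℝ), (0 < ν ∧ 0 < T ∧
        IsMaximalSmoothSolution ν 0 u p T ∧ IsLerayHopfOn T ν 0 (u 0) u ∧
        HasRapidSpatialDecay (u 0) ∧ IsTypeIBlowup u T ∧
        ¬ ∃ κ : ℝ, 0 < κ ∧ ∃ Ω : ℝ → ℝ, ∃ t₀ ∈ Set.Ico 0 T, ∀ t ∈ Set.Ico t₀ T,
          (∃ x : EuclideanSpace ℝ (Fin 3), Ω t < ‖curl (u t) x‖) ∧ ∀ x : EuclideanSpace ℝ (Fin 3), Ω t < ‖curl (u t) x‖ →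
            κ * ‖curl (u t) x‖ ^ 2 * Laplacian.laplacian (p t) x ≤
              iteratedFDeriv ℝ 2 (p t) x ![curl (u t) x, curl (u t) x]) →
      ∃ (v : ℝ → EuclideanSpace ℝ (Fin 3) → EuclideanSpace ℝ (Fin 3)) (q : ℝ → EuclideanSpace ℝ (Fin 3) → ℝ),
          IsKNSSBlowupLimit v ∧
        IsClassicalNSSolutionOn (Set.Iio 0) 1 0 v q ∧
        (∃ z₀ : ℝ × (EuclideanSpace ℝ (Fin 3)), z₀.1 < 0 ∧
          (fun z : ℝ × (EuclideanSpace ℝ (Fin 3)) => inner ℝ (curl (v z.1) z.2) (gradient (q z.1) z.2)) =ᶠ[𝓝 z₀] 0) ∧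
        ¬ (∀ t < 0, ∃ b : EuclideanSpace ℝ (Fin 3), v t = fun _ => b) := by
  rintro ν T u p ⟨hν, hT, hmax, hLH, hdec, hI, hnb⟩
  obtain ⟨v, q, hv, hvq, hcol, hnc⟩ := hD ν T hν hT u p hmax hLH hdec hI hnb
  refine ⟨v, q, hv, hvq, ⟨((-1 : ℝ), (0 : EuclideanSpace ℝ (Fin 3))), by norm_num, ?_⟩, hnc⟩
  have hmem : Set.Iio (0 : ℝ) ×ˢ (Set.univ : Set (EuclideanSpace ℝ (Fin 3))) ∈ 𝓝 ((-1 : ℝ), (0 : EuclideanSpace ℝ (Fin 3))) :=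
    prod_mem_nhds (Iio_mem_nhds (by norm_num)) univ_mem
  filter_upwards [hmem] with z hz
  exact hcol z.1 hz.1 z.2

/-- **The localised selection already breaks Liouville.** Whatever the germ condition, stub L3
asserts — under the crux's antecedent — a KNSS limit with classical pressure that is NOT slice-wise
constant, i.e. a counterexample to the KNSS Liouville statement in the tree's classical-pressure
class. So any proof of L3 proves `(Type-I ∧ ¬blob exclusion) ∨ ¬(Liouville)`: L3 is crux-sized. -/
theorem antiLiouville_of_localSelection
    (h3 : ∀ (ν T : ℝ) (u : ℝ → EuclideanSpace ℝ (Fin 3) → EuclideanSpace ℝ (Fin 3))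
        (p : ℝ → EuclideanSpace ℝ (Fin 3) → ℝ), (0 < ν ∧ 0 < T ∧
        IsMaximalSmoothSolution ν 0 u p T ∧ IsLerayHopfOn T ν 0 (u 0) u ∧
        HasRapidSpatialDecay (u 0) ∧ IsTypeIBlowup u T ∧
        ¬ ∃ κ : ℝ, 0 < κ ∧ ∃ Ω : ℝ → ℝ, ∃ t₀ ∈ Set.Ico 0 T, ∀ t ∈ Set.Ico t₀ T,
          (∃ x : EuclideanSpace ℝ (Fin 3), Ω t < ‖curl (u t) x‖) ∧ ∀ x : EuclideanSpace ℝ (Fin 3), Ω t < ‖curl (u t) x‖ →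
            κ * ‖curl (u t) x‖ ^ 2 * Laplacian.laplacian (p t) x ≤
              iteratedFDeriv ℝ 2 (p t) x ![curl (u t) x, curl (u t) x]) →
      ∃ (v : ℝ → EuclideanSpace ℝ (Fin 3) → EuclideanSpace ℝ (Fin 3)) (q : ℝ → EuclideanSpace ℝ (Fin 3) → ℝ),
          IsKNSSBlowupLimit v ∧
        IsClassicalNSSolutionOn (Set.Iio 0) 1 0 v q ∧
        (∃ z₀ : ℝ × (EuclideanSpace ℝ (Fin 3)), z₀.1 < 0 ∧
          (fun z : ℝ × (EuclideanSpace ℝ (Fin 3)) => inner ℝ (curl (v z.1) z.2) (gradient (q z.1) z.2)) =ᶠ[𝓝 z₀] 0) ∧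
        ¬ (∀ t < 0, ∃ b : EuclideanSpace ℝ (Fin 3), v t = fun _ => b))
    {ν T : ℝ} {u : ℝ → EuclideanSpace ℝ (Fin 3) → EuclideanSpace ℝ (Fin 3)} {p : ℝ → EuclideanSpace ℝ (Fin 3) → ℝ} (hant : 0 < ν ∧ 0 < T ∧
        IsMaximalSmoothSolution ν 0 u p T ∧ IsLerayHopfOn T ν 0 (u 0) u ∧
        HasRapidSpatialDecay (u 0) ∧ IsTypeIBlowup u T ∧
        ¬ ∃ κ : ℝ, 0 < κ ∧ ∃ Ω : ℝ → ℝ, ∃ t₀ ∈ Set.Ico 0 T, ∀ t ∈ Set.Ico t₀ T,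
          (∃ x : EuclideanSpace ℝ (Fin 3), Ω t < ‖curl (u t) x‖) ∧ ∀ x : EuclideanSpace ℝ (Fin 3), Ω t < ‖curl (u t) x‖ →
            κ * ‖curl (u t) x‖ ^ 2 * Laplacian.laplacian (p t) x ≤
              iteratedFDeriv ℝ 2 (p t) x ![curl (u t) x, curl (u t) x]) :
    ∃ (v : ℝ → EuclideanSpace ℝ (Fin 3) → EuclideanSpace ℝ (Fin 3)) (q : ℝ → EuclideanSpace ℝ (Fin 3) → ℝ),
          IsKNSSBlowupLimit v ∧
      IsClassicalNSSolutionOn (Set.Iio 0) 1 0 v q ∧ ¬ (∀ t < 0, ∃ b : EuclideanSpace ℝ (Fin 3), v t = fun _ => b) := by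
  obtain ⟨v, q, hv, hvq, -, hnc⟩ := h3 ν T u p hant
  exact ⟨v, q, hv, hvq, hnc⟩

end Summit.NavierStokesRegularity.NavierStokesRegularity.Theorems

end
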